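import Summits.CriticalPhenomena.PercolationContinuityZ3.Theorems.Transplant.SkelNegBParamsResidualsAF
import Summits.CriticalPhenomena.PercolationContinuityZ3.Theorems.Transplant.SkelNegBChoiceAllTA
import HarnessLib

/-!
# N1 params — **THE THREE SLOT SERVERS OF THE (F) GLUE at slot-ledger (ζ′) v2** (`Hmx` at `mx := NegB.mxRA`, `Hex` at `ex := NegB.exAF cF`,
# `HSF` at `gx := KS.gxA cF`), in the glue's own `∀ (κ Φ t p O)`-form (hp-8 g36, HOME/prim-hp-8/F-GLUE-CONSUMER-SHAPE.md §1:
# `NegB.faceHoldsRNOFnL_negChoiceAllOTA_of_floors (cF gx fx ex mx) (Hmx Hex HSF) (FloorsS FloorsD FloorsT)`), so that the unconditional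
# corollary reads `…_of_floors cF (KS.gxA cF) KS.fxA (NegB.exAF cF) NegB.mxRA (Hmx_mxRA _ _) (Hex_exAF cF _ _) (HSF_gxA cF) FloorsS FloorsD FloorsT`.
All three are re-packagings of LANDED facts: `NegB.mF_le_mxRA` (ResidualsA p318016), `NegB.hex_exAF` (ResidualsAF p323083),
`(KS.ML_floorsA …).2.2.2.1` (ResidualsA); `gOf κ Φ t p O gv = gv κ Φ t p O.merged` and `fOf … = …` are `rfl`.  (stmt-g17 2026-08-22.)
builds on p205010 (kernel theorem, internal audit signed; external expert review pending) — nothing in this file uses p205010; NOTHING is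
claimed about the node `SamePDropOfSkeletonNeg₁` (OPEN); bookkeeping only.
Lane `prim-bschramm-*`, seat `prim-bschramm-stmt` (gen 17); helper file (`--supports stmt-CriticalPhenomena-4575 --as helper`); slot-ledger ζ′ v2
(lane INBOX 2026-08-22T08:17:44Z / 08:18:43Z; HOME/prim-bschramm-stmt/NEG-PARAMS.md v0.19c).
[cite: KozmaNitzan2024, §4 Lemma 12 (pp. 23–25)]
-/

noncomputable section

open scoped Classical

namespace Summit.CriticalPhenomena.PercolationContinuityZ3.Theorems.Transplant

namespace PlanarSkeletonNeg

namespace NegB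

open Literature.Probability.Percolation Literature.Probability.LatticeModels SimpleGraph
open SkelConc (Consts)
open Skelφ.StepI (DataN OutO)
open Neg

/-- **`Hmx` at the node value `mx := NegB.mxRA`**: `mF (fcellsA) ≤ mxRA` at every point, in the glue's `∀`-form. [folklore] -/
theorem Hmx_mxRA (gx fx : Neg.FSlot) :
    ∀ (κ : Consts) {V : Type} [DecidableEq V] [Countable V] {G : SimpleGraph V} [G.LocallyFinite] (Φ : PlanarSkeletonNeg G) (t : V) (p : unitInterval)
      (O : OutO V),
      (prFA κ Φ t p O.merged (gOf κ Φ t p O (KS.gT 0 gx)) (fOf κ Φ t p O (KS.fT 0 fx))).mF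
          (fcellsA κ Φ t p O.merged (gOf κ Φ t p O (KS.gT 0 gx)) (fOf κ Φ t p O (KS.fT 0 fx))) ≤
        ((mxRA κ Φ t p O.merged (gOf κ Φ t p O (KS.gT 0 gx)) (fOf κ Φ t p O (KS.fT 0 fx)) : ℕ) : ℤ) :=
  fun κ _ _ _ _ _ Φ t p O => mF_le_mxRA κ Φ t p O.merged _ _

/-- **`Hex` at `ex := NegB.exAF cF`** (slot-ledger ζ′ v2): `exA ≤ exAF cF` and the F pair's kit floor `r₀A 0 (R (scale (MBF cF 0) (nBF cF 0))) + 1 ≤ exAF cF`,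
in the glue's `∀`-form. [folklore] -/
theorem Hex_exAF (cF : ℕ) (gx fx : Neg.FSlot) :
    ∀ (κ : Consts) {V : Type} [DecidableEq V] [Countable V] {G : SimpleGraph V} [G.LocallyFinite] (Φ : PlanarSkeletonNeg G) (t : V) (p : unitInterval)
      (O : OutO V),
      exA κ Φ t p O.merged (gOf κ Φ t p O (KS.gT 0 gx)) (fOf κ Φ t p O (KS.fT 0 fx)) ≤ exAF cF κ Φ t p O.merged (gOf κ Φ t p O (KS.gT 0 gx)) (fOf κ Φ t p O (KS.fT 0 fx)) ∧
      KS.r₀A Φ t O.merged 0 (O.merged.R (O.merged.scale t (KS.MBF κ Φ t p O.merged cF 0) (KS.nBF κ Φ t p O.merged cF 0))) + 1 ≤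
        exAF cF κ Φ t p O.merged (gOf κ Φ t p O (KS.gT 0 gx)) (fOf κ Φ t p O (KS.fT 0 fx)) :=
  fun κ _ _ _ _ _ Φ t p O => hex_exAF κ Φ t p O.merged cF _ _

/-- **`HSF` at `gx := KS.gxA cF`**: `16·SF cF 0 ≤ ML (gT 0 (gxA cF))` at every point, in the glue's `∀`-form (conjunct 4 of `KS.ML_floorsA`). [folklore] -/
theorem HSF_gxA (cF : ℕ) :
    ∀ (κ : Consts) {V : Type} [DecidableEq V] [Countable V] {G : SimpleGraph V} [G.LocallyFinite] (Φ : PlanarSkeletonNeg G) (t : V) (p : unitInterval)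
      (O : OutO V),
      16 * KS.SF κ Φ t p O.merged cF 0 ≤ ML κ Φ t p O.merged (gOf κ Φ t p O (KS.gT 0 (KS.gxA cF))) :=
  fun κ _ _ _ _ _ Φ t p O => (KS.ML_floorsA κ Φ t p O.merged cF).2.2.2.1

/-- The stronger form `64·SF cF 0 ≤ ML (gT 0 (gxA cF))` (conjunct 3 of `KS.ML_floorsA`), same `∀`-form. [folklore] -/
theorem HSF64_gxA (cF : ℕ) :
    ∀ (κ : Consts) {V : Type} [DecidableEq V] [Countable V] {G : SimpleGraph V} [G.LocallyFinite] (Φ : PlanarSkeletonNeg G) (t : V) (p : unitInterval)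
      (O : OutO V),
      64 * KS.SF κ Φ t p O.merged cF 0 ≤ ML κ Φ t p O.merged (gOf κ Φ t p O (KS.gT 0 (KS.gxA cF))) :=
  fun κ _ _ _ _ _ Φ t p O => (KS.ML_floorsA κ Φ t p O.merged cF).2.2.1

end NegB

end PlanarSkeletonNeg

end Summit.CriticalPhenomena.PercolationContinuityZ3.Theorems.Transplant

end
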